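import Mathlib
import Summits.AtomisticToContinuum.HydrodynamicLimit.Theorems.ImplosionDichotomyDenseExcursionPackingAnalyticSourcesWeighted

/-!
# The MODIFIED source bound of the hierarchy of `Γ` under `PackingResolventW`: the mixed two-scale norm, pointwise
# (crux `DenseExcursion`, stmt-AtomisticToContinuum-12586, line `sonic-cavity-renewal` v8, stub `stub_analyticPackingImplosion`)

Helper file (`--supports stmt-AtomisticToContinuum-12586`, line lead a2, wave-4 worker D1, task (0): the modified
`packingSources_bound` of the two-scale closure). The order-`k` source `Src_k = (Src_w, Src_s)` of `packingHierarchy_order`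
is measured in the MIXED norm `|Src_w|/(1 + S) + |Src_w|/k + |Src_s|/S` (the source norm `N` of `twoScale_linear_step`),
and the lower orders `X_i = (w_i, s_i)`, `v_i = s_i/S`, by the two-scale densities delivered by `twoScale_linear_step`:
`T_i ≥ |w_i| + |w_i′| + |v_i| + (1 + S)|v_i′|` (all `O(N_i)`, no factor `i`) together with the ONE lossy density
`(1 + S)²|v_i′| ≤ k·T_i` (`i < k`; genuinely `≍ iμ|w_i|/3 ≤ k·O(N_i)` in the acoustic layer). Kernel-checked here:

* `packingSources_bound_twoScale` (REGISTERED helper): under these hypotheses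
  `|Src_w|/(1+S) + |Src_w|/k + |Src_s|/S ≤ 2·[(9 + 3σ₂ + σ₁)[Gᵏ](2T)² + 3(1+σ₂) Σ_{p<k} [Gᵖ](1+2T)² Σ_{j≤k−p} |m_j| Φʲ [G^{k−p−j}](1+2T)^{3j}]`
  — `packingSources_bound_weighted` twice, with `ω = 1/(1+S)` (`1 + S²/(1+S) ≤ 1 + S`) and `ω = 1/k`
  (`S²|v′|/k ≤ (1+S)²|v′|/k ≤ T_i`), both with the majorant numbers `2T_i`.

So the recursion of the closure reads, with `t_i := sup_x T_i(x)` and the constant `C` of `twoScale_linear_step`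
(`T_i ≤ 3C·N_i` off the sonic window): `N_k ≤ 2·Σ_{n ∈ Ico 2 (k+1)} a_n [Gᵏ](2T)ⁿ` (`majorant_shift`, `a_n ≤ A αⁿ` by
`majorant_shift_coeff_le`), i.e. the hypothesis of `analytic_majorant_seeded` for `t_k` up to the constant `2·3C·2ⁿ`
absorbed in `(A, α)`: GEOMETRIC growth, no factor `k` compounds. NOT here: the sonic window (task (1)), the summation, `Γ`.
-/

noncomputable section

open Finset PowerSeries

namespace Summit.AtomisticToContinuum.HydrodynamicLimit.Theorems.PackingAnalyticImplosion

/-- **THE SOURCES IN THE MIXED TWO-SCALE NORM, POINTWISE** (registered helper `packingSources_bound_twoScale` of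
`stub_analyticPackingImplosion`): at a point `x`, with `S = sc 0 > 0`, `σ₁ ≥ |S′/S|`, `σ₂ ≥ |S(S′+S)|`, `Φ ≥ e^{3x}S³`,
two-scale majorant numbers `T_i ≥ |wc i| + |wc i′| + |sc i|/S + (1 + S)|(sc i/S)′|` and `(1 + S)²|(sc i/S)′| ≤ k·T_i`
for `1 ≤ i < k` (`T₀ = 0`, `T ≥ 0`), the order-`k` sources of `packingHierarchy_order` satisfy
`|Src_w|/(1+S) + |Src_w|/k + |Src_s|/S ≤ 2[(9 + 3σ₂ + σ₁)[Gᵏ](2T)² + 3(1+σ₂) Σ_{p<k} [Gᵖ](1+2T)² Σ_{j≤k−p} |m_j| Φʲ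
[G^{k−p−j}](1+2T)^{3j}]`. [folklore] -/
theorem packingSources_bound_twoScale : ∀ (wc sc : ℕ → ℝ → ℝ) (m : ℕ → ℝ) (Mc : ℕ → ℝ → ℝ) (Sw Ss : ℝ → ℝ) (T : ℕ → ℝ) (k : ℕ) (x σ₁ σ₂ Φ : ℝ), (∀ c, Mc c x = ∑ j ∈ Finset.range (c + 1), m j * Real.exp (3 * x) ^ j * PowerSeries.coeff (c - j) ((PowerSeries.mk fun n => sc n x) ^ (3 * j))) → (Sw x = (∑ i ∈ Finset.Ico 1 k, (wc i x * deriv (wc (k - i)) x + wc i x * wc (k - i) x + 3 * (sc i x * (deriv (sc (k - i)) x + sc (k - i) x)))) + 3 * ∑ p ∈ Finset.range k, (∑ i ∈ Finset.range (p + 1), sc i x * (deriv (sc (p - i)) x + sc (p - i) x)) * Mc (k - p) x) → (Ss x = ∑ i ∈ Finset.Ico 1 k, (wc i x * deriv (sc (k - i)) x + sc i x / 3 * deriv (wc (k - i)) x + 2 * (sc i x * wc (k - i) x))) → 0 < sc 0 x → (∀ i, i < k → DifferentiableAt ℝ (sc i) x) → |deriv (sc 0) x / sc 0 x| ≤ σ₁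 → |sc 0 x * (deriv (sc 0) x + sc 0 x)| ≤ σ₂ → Real.exp (3 * x) * sc 0 x ^ 3 ≤ Φ → T 0 = 0 → (∀ i, 0 ≤ T i) → (∀ i, 1 ≤ i → i < k → |wc i x| + |deriv (wc i) x| + |sc i x| / sc 0 x + (1 + sc 0 x) * |deriv (fun y => sc i y / sc 0 y) x| ≤ T i) → (∀ i, 1 ≤ i → i < k → (1 + sc 0 x) ^ 2 * |deriv (fun y => sc i y / sc 0 y) x| ≤ k * T i) → |Sw x| / (1 + sc 0 x) + |Sw x| / k + |Ss x| / sc 0 x ≤ 2 * ((9 + 3 * σ₂ + σ₁) * PowerSeries.coeff k (PowerSeries.mk (fun i => 2 * T i) ^ 2) + 3 * (1 + σ₂) * ∑ p ∈ Finset.range k, PowerSeries.coeff p ((1 + PowerSeries.mk fun i => 2 * T i) ^ 2) * ∑ j ∈ Finset.range (k - p + 1), |m j| * Φ ^ j * PowerSeries.coeff (k - p - j) ((1 + PowerSeries.mk fun i => 2 * T i) ^ (3 * j))) := by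
  intro wc sc m Mc Sw Ss T k x σ₁ σ₂ Φ hMc hSw hSs hS hdiff hσ₁ hσ₂ hΦ hT0 hTnn hT hD
  set S : ℝ := sc 0 x with hSdef
  have hS1 : 0 < 1 + S := by linarith
  have hT20 : (fun i => 2 * T i) 0 = 0 := by simp [hT0]
  have hT2nn : ∀ i, 0 ≤ (fun i => 2 * T i) i := fun i => by simp only; linarith [hTnn i]
  have hv'0 : ∀ i, 0 ≤ |deriv (fun y => sc i y / sc 0 y) x| := fun i => abs_nonneg _
  -- weight `ω = 1/(1+S)`
  have h1 := packingSources_bound_weighted wc sc m Mc Sw Ss (fun i => 2 * T i) k x σ₁ σ₂ Φ (1 / (1 + S)) hMc hSw hSs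
    hS hdiff hσ₁ hσ₂ hΦ (by positivity) (by rw [div_le_one hS1]; linarith) hT20 hT2nn (fun i hi1 hik => by
      have h := hT i hi1 hik
      have hw : (1 + 1 / (1 + S) * S ^ 2) ≤ 1 + S := by
        rw [add_le_add_iff_left, div_mul_eq_mul_div, one_mul, div_le_iff₀ hS1]; nlinarith
      have h2 : (1 + 1 / (1 + S) * S ^ 2) * |deriv (fun y => sc i y / sc 0 y) x| ≤
          (1 + S) * |deriv (fun y => sc i y / sc 0 y) x| := mul_le_mul_of_nonneg_right hw (hv'0 i)
      show _ ≤ 2 * T i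
      linarith [hTnn i])
  -- weight `ω = 1/k`
  have hk1 : (1 : ℝ) / k ≤ 1 := by
    rcases Nat.eq_zero_or_pos k with hk | hk
    · simp [hk]
    · rw [div_le_one (by exact_mod_cast hk)]; exact_mod_cast hk
  have h2 := packingSources_bound_weighted wc sc m Mc Sw Ss (fun i => 2 * T i) k x σ₁ σ₂ Φ (1 / k) hMc hSw hSs
    hS hdiff hσ₁ hσ₂ hΦ (by positivity) hk1 hT20 hT2nn (fun i hi1 hik => by
      have h := hT i hi1 hik
      have hd := hD i hi1 hik
      have hkpos : (0 : ℝ) < k := by exact_mod_cast (lt_of_lt_of_le Nat.zero_lt_one (hi1.trans hik.le))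
      have h3 : 1 / k * S ^ 2 * |deriv (fun y => sc i y / sc 0 y) x| ≤ T i := by
        rw [one_div, mul_assoc, inv_mul_le_iff₀ hkpos]
        have : S ^ 2 * |deriv (fun y => sc i y / sc 0 y) x| ≤ (1 + S) ^ 2 * |deriv (fun y => sc i y / sc 0 y) x| :=
          mul_le_mul_of_nonneg_right (by nlinarith) (hv'0 i)
        linarith
      have h4 : |deriv (fun y => sc i y / sc 0 y) x| ≤ (1 + S) * |deriv (fun y => sc i y / sc 0 y) x| :=
        le_mul_of_one_le_left (hv'0 i) (by linarith)
      show _ ≤ 2 * T i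
      nlinarith [h, h3, h4, hv'0 i])
  -- add
  have hSs0 : 0 ≤ |Ss x| / S := by positivity
  have e1 : 1 / (1 + S) * |Sw x| = |Sw x| / (1 + S) := by ring
  have e2 : 1 / (k : ℝ) * |Sw x| = |Sw x| / k := by ring
  rw [e1] at h1
  rw [e2] at h2
  linarith

end Summit.AtomisticToContinuum.HydrodynamicLimit.Theorems.PackingAnalyticImplosion

end
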